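import Mathlib
import HarnessLib
import Literature.Dynamics.TransferOperators.ChangMayerEigenfunction
import Literature.Dynamics.TransferOperators.MayerTransferCompact

/-!
# Eisenstein projection identities for Mayer's transfer operator

Two exact, ζ-carrying identities for Mayer's continued transfer operator `L_s` of the Gauss map on
`B(D)` (`mayerTransfer s`), valid for every parameter with `2s ∈ psiDomain` (in particular on the
whole open strip `0 < Re s < 1/2`), both immediate consequences of the Chang–Mayer identity
`L_s h_s = h_s − (ζ(2s)/2)·𝟙` for `h_s(z) = ψ(2s, z+1)` ([ChangMayer2001, (4.36)–(4.38), Prop. 4.1(v)];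
in tree as `mayerTransfer_zagierPsi_toFun`):

* `mayerTransfer_eq_sub_smul_of_zagierPsi` — the identity as an equation in `B(D)`:
  `L_s H = H − (ζ(2s)/2) • E` for any `H, E ∈ B(D)` with `H = ψ(2s, ·+1)`, `E = 1` on the closed disc.
* `eisenstein_projection_identity` — for every LEFT eigenfunctional `ℓ ∘ L_s = μ ℓ`:
  `(μ − 1) ℓ(H) = −(ζ(2s)/2) ℓ(E)`.  (So an eigenvalue branch `k` reads
  `λ_k(s) = 1 − (ζ(2s)/2) ℓ_k(E)/ℓ_k(H)` wherever `ℓ_k(H) ≠ 0`; at a zero of `ζ(2s)` it passes through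
  `1` iff `ℓ_k(H) ≠ 0`; its `s`-derivative at `ρ/2` is the Fermi-golden-rule formula used in the
  crux analysis of route `RiemannHypothesis/MayerPairing`.)
* `resolvent_one_apply_zero` — if `ζ(2s) ≠ 0`, `1 − L_s` is injective and `(1 − L_s) G = E`, then
  `G = (2/ζ(2s)) • H`, whence `G(0) = 2 ζ(2s−1)/ζ(2s)` (`H(0) = ψ(2s, 1) = ζ(2s−1)`, `zagierPsi_one`).

No new definitions: `H` and `E` enter through their point values on the closed disc, so the lemmas
apply verbatim to the element `MayerSpace.mk (fun u => zagierPsi (2*s) (u+1)) _ _` of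
`ChangMayerEigenfunction` and to the constant function `1`.
-/

namespace Literature.Dynamics.TransferOperators

open Complex

/-- **Chang–Mayer identity in `B(D)`.** For `2s ∈ psiDomain` and `H, E ∈ B(D)` with
`H(z) = ψ(2s, z+1)` and `E(z) = 1` on the closed disc `D̄`, Mayer's operator satisfies
`L_s H = H − (ζ(2s)/2) • E`. Pointwise this is `mayerTransfer_zagierPsi_toFun`.
[cite: ChangMayer2001, Prop. 4.1(v) and (4.36)–(4.38)] -/
theorem mayerTransfer_eq_sub_smul_of_zagierPsi {s : ℂ} (hσ : 2 * s ∈ psiDomain) {H E : MayerSpace}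
    (hH : ∀ z ∈ mayerClosedDisc, H.toFun z = zagierPsi (2 * s) (z + 1))
    (hE : ∀ z ∈ mayerClosedDisc, E.toFun z = 1) :
    mayerTransfer s H = H - (riemannZeta (2 * s) / 2) • E := by
  -- `H` is the Chang–Mayer element of `B(D)`
  have hHmk : H = MayerSpace.mk (fun u => zagierPsi (2 * s) (u + 1))
      (continuousOn_zagierPsi_add_one (ne_one_of_mem_psiDomain hσ).1 hσ.1)
      (differentiableOn_zagierPsi_add_one_mayerDisc (ne_one_of_mem_psiDomain hσ).1 hσ.1) :=
    MayerSpace.ext fun z hz => by rw [hH z hz, MayerSpace.mk_toFun_apply _ _ _ hz]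
  refine MayerSpace.ext fun z hz => ?_
  rw [MayerSpace.toFun_sub, MayerSpace.toFun_smul, Pi.sub_apply, Pi.smul_apply, smul_eq_mul,
    hH z hz, hE z hz, mul_one, hHmk, mayerTransfer_zagierPsi_toFun hσ ⟨z, hz⟩]

/-- **Eisenstein projection identity.** For `2s ∈ psiDomain`, every left eigenfunctional
`ℓ ∘ L_s = μ ℓ` of Mayer's operator on `B(D)` satisfies `(μ − 1) ℓ(H) = −(ζ(2s)/2) ℓ(E)`, where
`H = ψ(2s, ·+1)` and `E = 1` on the closed disc: apply `ℓ` to `L_s H = H − (ζ(2s)/2) • E`.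
[cite: ChangMayer2001, Prop. 4.1(v) and (4.36)–(4.38)] -/
theorem eisenstein_projection_identity {s : ℂ} (hσ : 2 * s ∈ psiDomain)
    (ℓ : MayerSpace →L[ℂ] ℂ) (μ : ℂ) (hℓ : ℓ.comp (mayerTransfer s) = μ • ℓ)
    {H E : MayerSpace} (hH : ∀ z ∈ mayerClosedDisc, H.toFun z = zagierPsi (2 * s) (z + 1))
    (hE : ∀ z ∈ mayerClosedDisc, E.toFun z = 1) :
    (μ - 1) * ℓ H = -(riemannZeta (2 * s) / 2) * ℓ E := by
  have h1 : ℓ (mayerTransfer s H) = μ * ℓ H := by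
    have := congrArg (fun T : MayerSpace →L[ℂ] ℂ => T H) hℓ
    simpa using this
  rw [mayerTransfer_eq_sub_smul_of_zagierPsi hσ hH hE, map_sub, map_smul, smul_eq_mul] at h1
  linear_combination -h1

/-- **Eisenstein projection identity on the open strip** `0 < Re s < 1/2` (the form used by route
`RiemannHypothesis/MayerPairing`): `(μ − 1) ℓ(H) = −(ζ(2s)/2) ℓ(E)` for every left eigenfunctional
`ℓ ∘ L_s = μ ℓ`. [cite: ChangMayer2001, Prop. 4.1(v) and (4.36)–(4.38)] -/
theorem eisenstein_projection_identity_of_strip {s : ℂ} (hs0 : 0 < s.re) (hs1 : s.re < 1 / 2)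
    (ℓ : MayerSpace →L[ℂ] ℂ) (μ : ℂ) (hℓ : ℓ.comp (mayerTransfer s) = μ • ℓ)
    (H : MayerSpace) (hH : ∀ z ∈ mayerClosedDisc, H.toFun z = zagierPsi (2 * s) (z + 1))
    (E : MayerSpace) (hE : ∀ z ∈ mayerClosedDisc, E.toFun z = 1) :
    (μ - 1) * ℓ H = -(riemannZeta (2 * s) / 2) * ℓ E :=
  eisenstein_projection_identity ⟨by simpa using hs0, Or.inr (by simp; linarith)⟩ ℓ μ hℓ hH hE

/-- **The resolvent of `L_s` at `1` applied to the constant function.** For `2s ∈ psiDomain` with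
`ζ(2s) ≠ 0`: if `1 − L_s` is injective on `B(D)` and `G − L_s G = E` (`E = 1` on the closed disc),
then `G = (2/ζ(2s)) • H` with `H = ψ(2s, ·+1)`; in particular `G(0) = 2 ζ(2s−1)/ζ(2s)` since
`H(0) = ψ(2s, 1) = ζ(2s − 1)` (`zagierPsi_one`). [cite: ChangMayer2001, Prop. 4.1(v) and (4.36)–(4.38)] -/
theorem resolvent_one_eq_smul {s : ℂ} (hσ : 2 * s ∈ psiDomain) (hζ : riemannZeta (2 * s) ≠ 0)
    (hinj : ∀ f : MayerSpace, mayerTransfer s f = f → f = 0) {G H E : MayerSpace}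
    (hH : ∀ z ∈ mayerClosedDisc, H.toFun z = zagierPsi (2 * s) (z + 1))
    (hE : ∀ z ∈ mayerClosedDisc, E.toFun z = 1) (hG : G - mayerTransfer s G = E) :
    G = (2 / riemannZeta (2 * s)) • H := by
  have hLH := mayerTransfer_eq_sub_smul_of_zagierPsi hσ hH hE
  -- `G' := (2/ζ(2s)) • H` solves the same equation
  have hG' : (2 / riemannZeta (2 * s)) • H - mayerTransfer s ((2 / riemannZeta (2 * s)) • H) = E := by
    rw [map_smul, hLH, smul_sub, sub_sub_cancel, smul_smul]
    have : 2 / riemannZeta (2 * s) * (riemannZeta (2 * s) / 2) = 1 := by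
      field_simp
    rw [this, one_smul]
  -- so the difference is a fixed vector of `L_s`, hence zero
  have hfix : mayerTransfer s (G - (2 / riemannZeta (2 * s)) • H) =
      G - (2 / riemannZeta (2 * s)) • H := by
    rw [map_sub]
    exact (sub_eq_sub_iff_sub_eq_sub.mp (hG.trans hG'.symm)).symm
  exact sub_eq_zero.mp (hinj _ hfix)

/-- **`⟨δ₀, (1 − L_s)⁻¹ 𝟙⟩ = 2 ζ(2s−1)/ζ(2s)`** on the open strip `0 < Re s < 1/2` (where
`ζ(2s) ≠ 0` is assumed and `1 ∉ spec L_s` is expressed as injectivity of `1 − L_s`): the value at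
the cusp `0` of the solution `G` of `(1 − L_s) G = 𝟙`. Through the Neumann series this is the
generating function `Σ_q 2 φ(q) q^{−2s}` of the Euclidean algorithm (Hensley; Baladi–Vallée); here
only the exact closed form is recorded. [cite: ChangMayer2001, Prop. 4.1(v) and (4.36)–(4.38)] -/
theorem resolvent_one_apply_zero {s : ℂ} (hs0 : 0 < s.re) (hs1 : s.re < 1 / 2)
    (hζ : riemannZeta (2 * s) ≠ 0) (hinj : ∀ f : MayerSpace, mayerTransfer s f = f → f = 0)
    (G E : MayerSpace) (hE : ∀ z ∈ mayerClosedDisc, E.toFun z = 1)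
    (hG : G - mayerTransfer s G = E) :
    G.toFun 0 = 2 * riemannZeta (2 * s - 1) / riemannZeta (2 * s) := by
  have hσ : 2 * s ∈ psiDomain := ⟨by simpa using hs0, Or.inr (by simp; linarith)⟩
  set H : MayerSpace := MayerSpace.mk (fun u => zagierPsi (2 * s) (u + 1))
      (continuousOn_zagierPsi_add_one (ne_one_of_mem_psiDomain hσ).1 hσ.1)
      (differentiableOn_zagierPsi_add_one_mayerDisc (ne_one_of_mem_psiDomain hσ).1 hσ.1) with hHdef
  have hH : ∀ z ∈ mayerClosedDisc, H.toFun z = zagierPsi (2 * s) (z + 1) := fun z hz =>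
    MayerSpace.mk_toFun_apply _ _ _ hz
  have hGH := resolvent_one_eq_smul hσ hζ hinj hH hE hG
  rw [hGH, MayerSpace.toFun_smul, Pi.smul_apply, smul_eq_mul, hH 0 zero_mem_mayerClosedDisc,
    zero_add, zagierPsi_one hσ]
  field_simp

end Literature.Dynamics.TransferOperators
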